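import Literature.Geometry.Kaehler.ComplexTorusHodgeLieAlgebraRatProductStablyNondegenerate
import HarnessLib

/-!
# «If `X` has no factors of Type IV then `Hg(X)` is semi-simple» (Moonen–Zarhin §1) OVER `ℚ`: Rosati trivial on `Z(End⁰(X))`
# ⟹ `𝒜(X) ∩ End⁰(X) = 0` ⟹ `𝒜(X)` is semisimple over `ℚ`; `𝒜` abelian ⟺ `Hg(X)` commutative (every torus); and the
# product criteria of the gen-42 `ℚ`-dictionary under the arithmetic «no type IV» hypothesis

Layer `Literature/Geometry/Kaehler`, namespace `Literature.Geometry.Kaehler.ComplexTorus`; lane `lit-hodgefound` (Track 2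
foundations library), Layer A3/A4; prover seat `lit-hodgefound-p17` (generation 42, self-proposed row g42-#9).  The hypothesis
dictionary that plugs the ARITHMETIC hypotheses of Moonen–Zarhin ∕ Hazama into the `ℚ`-Lie criteria of g42-#2 … g42-#8:
«no factor of type IV» in the tree's precise form (the Rosati involution is the identity on the centre of `End⁰(X)`;
`ComplexTorusHodgeGroupCenterFinite`, `ComplexTorusHodgeLieAlgebraNoTypeFourSemisimple` for the `ℂ`-form) gives
`𝒜(X) ∩ End⁰(X) = 0` over `ℚ` in two lines (an element of `𝒜 ∩ End⁰` is central in `End⁰` — `End⁰ = End^{𝒜}`, p36 — hence Rosati-FIXED,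
and Rosati-ANTISYMMETRIC as an element of `𝒜 ⊆ 𝔰𝔭`, p36 `IsRiemannForm.rosati_eq_neg_of_mem_hodgeGroupLieRat`), whence `𝔷(𝒜) = 0` and
`𝒜` semisimple over `ℚ` (p36 `IsRiemannForm.isSemisimple_hodgeGroupLieRat_iff_forall_mem_endAlgRat_eq_zero`) — Moonen–Zarhin's
statement where it lives, on the `ℚ`-group `Hg(X)`.  THEOREMS ONLY (no definition, no instance, no notation, no named fact; D-0026 net debt 0).

## Sources, verbatim

* B. Moonen, Yu. G. Zarhin [MoonenZarhin1999LowDim], Math. Ann. 315 (1999), §1 (held `paper:arxiv-math_9901113` p0002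
  L134–L136): "The Hodge group `Hg(X)` is a torus if and only if `X` is of CM-type. If `X` has no factors of Type 4 then `Hg(X)` is
  semi-simple."; §3 Thm. (3.2)(2) (p0006 L69–L78), Lemma (3.6), Prop. (3.8) (p0007).
* H. Lange [Lange2023AbelianVarietiesComplex], §7.2.2 Prop. 7.2.5, §7.2.3 Prop. 7.2.6, §7.2.4 Exercise (2) ("`Hg(X)` … is
  semisimple if and only if the centre of the Mumford–Tate group … consists only of scalars"), §5.5 (Albert types; the Rosati
  involution restricted to the centre of `End⁰` is the identity for types I–III and complex conjugation for type IV).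
* D. Mumford [MumfordAV1970], *Abelian Varieties*, §20–§21 (the Rosati involution; Albert's classification).
* B. B. Gordon [Gordon1997], §2.12, §2.16, 7.6.

## What is proved

* §1 NO TYPE IV OVER `ℚ` (polarised torus): **`IsRiemannForm.eq_zero_of_mem_hodgeGroupLieRat_of_mem_endAlgRat_of_forall_rosati_eq`**
  (`𝒜 ∩ End⁰ = 0`), `IsRiemannForm.center_hodgeGroupLieRat_eq_bot_of_forall_rosati_eq` (`𝔷(𝒜) = 0`),
  **`IsRiemannForm.isSemisimple_hodgeGroupLieRat_of_forall_rosati_eq`** (`𝒜` SEMISIMPLE OVER `ℚ` — Moonen–Zarhin §1; the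
  `End⁰(X) = ℚ` case is p36's `IsRiemannForm.isSemisimple_hodgeGroupLieRat_of_endAlgRat_eq_bot`),
  `IsRiemannForm.not_isLieAbelian_hodgeGroupLieRat_of_forall_rosati_eq` (no type IV and `dim X > 0` ⟹ `X` is not of CM type at `𝒜`).
* §2 EVERY TORUS: **`isLieAbelian_hodgeGroupLieRat_iff_hodgeGroup_comm`** (`𝒜` abelian ⟺ `Hg(X)(ℝ)` commutative),
  `isLieAbelian_hodgeGroupLieRat_iff_hodgeGroupC_comm`, `isLieAbelian_hodgeGroupLieRat_iff_commutator_hodgeGroupC_eq_bot`.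
* §3 PRODUCTS UNDER «NO TYPE IV» (`X₁` polarised, Rosati trivial on `Z(End⁰(X₁))`; the splitting `Hg(X₁ × X₂) = Hg(X₁) × Hg(X₂)`
  itself is already the tree's `IsRiemannForm.hodgeGroupC_prod_eq_blockDiagProd_of_forall_rosati_eq(_of_isSolvable ∕ _of_isCMType)`,
  `ComplexTorusHodgeGroupProduct{PerfectFactor,LiePerfectSolvable}` — not restated):
  **`IsRiemannForm.homRat_eq_bot_of_forall_rosati_eq_of_isSolvable`** (`𝒜(X₂)` solvable ⟹ `Hom_ℚ(X₁, X₂) = 0 = Hom_ℚ(X₂, X₁)`),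
  `…_of_forall_rosati_eq_of_commutator_hodgeGroupC_eq_bot` (`Hg(X₂)(ℂ)` commutative),
  `IsRiemannForm.hodgeGroupC_prod_ellipticPeriod_eq_blockDiagProd_of_forall_rosati_eq` (CM elliptic factor, Prop. (3.8)),
  `IsRiemannForm.forall_divisorClasses_powPeriod_prod_ellipticPeriod_eq_hodgeClasses_of_forall_rosati_eq` (+ Tate: `X₁ × E_τ` stably
  nondegenerate when `X₁` is).
-/

noncomputable section

open Matrix Module Function

namespace Literature.Geometry.Kaehler

namespace ComplexTorus

/-! ### §0 Plumbing -/

/-- A Lie subalgebra of `𝔤𝔩_ι(R)` (commutator bracket) is abelian iff its elements commute as matrices. [folklore] -/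
private theorem isLieAbelian_iff_forall_mul_comm {ι : Type*} [Fintype ι] [DecidableEq ι] {R : Type*} [CommRing R]
    (K : @LieSubalgebra R (Matrix ι ι R) _ LieRing.ofAssociativeRing LieAlgebra.ofAssociativeAlgebra) :
    IsLieAbelian K ↔ ∀ X ∈ K, ∀ Y ∈ K, X * Y = Y * X := by
  letI : LieRing (Matrix ι ι R) := LieRing.ofAssociativeRing
  letI : LieAlgebra R (Matrix ι ι R) := LieAlgebra.ofAssociativeAlgebra
  constructor
  · intro h X hX Y hY
    have h0 := congrArg Subtype.val (h.trivial ⟨X, hX⟩ ⟨Y, hY⟩)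
    rw [LieSubalgebra.coe_bracket, Ring.lie_def, ZeroMemClass.coe_zero] at h0
    exact sub_eq_zero.1 h0
  · intro h
    exact ⟨fun X Y ↦ Subtype.ext (by
      rw [LieSubalgebra.coe_bracket, Ring.lie_def, ZeroMemClass.coe_zero, h X.1 X.2 Y.1 Y.2, sub_self])⟩

/-! ### §1 No factors of type IV ⟹ `𝒜 ∩ End⁰ = 0` ⟹ `𝒜` semisimple over `ℚ` -/

section NoTypeFour

variable {ι : Type*} [Fintype ι] [DecidableEq ι] {E : Type*} [NormedAddCommGroup E] [NormedSpace ℂ E]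
  {Φ : (ι → ℝ) ≃L[ℝ] E} {η : E [⋀^Fin 2]→L[ℝ] ℝ}

/-- **NO TYPE IV ⟹ `𝒜(X) ∩ End⁰(X) = 0`** (polarised complex torus): if the Rosati involution is the identity on the centre of
`End⁰(X)`, then no non-zero element of `𝒜` is an endomorphism — such a `B` is central in `End⁰(X) = End_ℚ(V)^𝒜`, so `B' = B`,
while `B' = −B` for every `B ∈ 𝒜 ⊆ 𝔰𝔭(V, E)`. [cite: MoonenZarhin1999LowDim, §1 (p0002 L134–L136)]
[cite: Lange2023AbelianVarietiesComplex, §7.2.2 Prop. 7.2.5 and §5.5] -/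
theorem IsRiemannForm.eq_zero_of_mem_hodgeGroupLieRat_of_mem_endAlgRat_of_forall_rosati_eq (hη : IsRiemannForm Φ η)
    {G₀ : Matrix ι ι ℚ} (hG₀ : G₀.map (Rat.cast : ℚ → ℝ) = latticeGram Φ η)
    (htriv : ∀ B ∈ endAlgRat Φ, (∀ C ∈ endAlgRat Φ, B * C = C * B) → rosati G₀ B = B)
    {B : Matrix ι ι ℚ} (hB : B ∈ hodgeGroupLieRat Φ) (hBE : B ∈ endAlgRat Φ) : B = 0 := by
  have h1 : rosati G₀ B = B := htriv B hBE fun C hC ↦ mul_comm_of_mem_hodgeGroupLieRat_of_mem_endAlgRat hB hC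
  have h2 : rosati G₀ B = -B := hη.rosati_eq_neg_of_mem_hodgeGroupLieRat hG₀ hB
  have h3 : (2 : ℚ) • B = 0 := by
    rw [two_smul]
    nth_rewrite 2 [← h1]
    rw [h2, add_neg_cancel]
  exact (smul_eq_zero.1 h3).resolve_left two_ne_zero

/-- The `∀`-form used by the gen-42 criteria: no type IV ⟹ `∀ B ∈ 𝒜, B ∈ End⁰ → B = 0`. [cite: MoonenZarhin1999LowDim, §1 (p0002 L134–L136)] -/
theorem IsRiemannForm.forall_mem_endAlgRat_eq_zero_of_forall_rosati_eq (hη : IsRiemannForm Φ η)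
    {G₀ : Matrix ι ι ℚ} (hG₀ : G₀.map (Rat.cast : ℚ → ℝ) = latticeGram Φ η)
    (htriv : ∀ B ∈ endAlgRat Φ, (∀ C ∈ endAlgRat Φ, B * C = C * B) → rosati G₀ B = B) :
    ∀ B ∈ hodgeGroupLieRat Φ, B ∈ endAlgRat Φ → B = 0 :=
  fun _ hB hBE ↦ hη.eq_zero_of_mem_hodgeGroupLieRat_of_mem_endAlgRat_of_forall_rosati_eq hG₀ htriv hB hBE

/-- **No type IV ⟹ `𝔷(𝒜) = 0`** (`𝔷(𝒜) = 𝒜 ∩ End⁰`). [cite: MoonenZarhin1999LowDim, §1 (p0002 L134–L136)]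
[cite: Lange2023AbelianVarietiesComplex, §7.2.4 Exercise (2)] -/
theorem IsRiemannForm.center_hodgeGroupLieRat_eq_bot_of_forall_rosati_eq (hη : IsRiemannForm Φ η)
    {G₀ : Matrix ι ι ℚ} (hG₀ : G₀.map (Rat.cast : ℚ → ℝ) = latticeGram Φ η)
    (htriv : ∀ B ∈ endAlgRat Φ, (∀ C ∈ endAlgRat Φ, B * C = C * B) → rosati G₀ B = B) :
    LieAlgebra.center ℚ (hodgeGroupLieRat Φ) = ⊥ := by
  refine (LieSubmodule.eq_bot_iff _).2 fun x hx ↦ ?_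
  obtain ⟨B, hB⟩ := x
  have hBE : B ∈ endAlgRat Φ := (mk_mem_center_hodgeGroupLieRat_iff_mem_endAlgRat hB).1 hx
  exact Subtype.ext (hη.eq_zero_of_mem_hodgeGroupLieRat_of_mem_endAlgRat_of_forall_rosati_eq hG₀ htriv hB hBE)

/-- **MOONEN–ZARHIN §1 OVER `ℚ`: «If `X` has no factors of Type IV then `Hg(X)` is semi-simple»** — the RATIONAL Hodge Lie algebra
`𝒜 = Lie Hg(X)` (a `ℚ`-Lie algebra; `𝒜 ⊗ ℂ = Lie Hg(X)(ℂ)`) of a polarised complex torus whose Rosati involution is trivial on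
`Z(End⁰(X))` is SEMISIMPLE over `ℚ` (`𝒜` is reductive with `𝔷(𝒜) = 𝒜 ∩ End⁰ = 0`). [cite: MoonenZarhin1999LowDim, §1 (p0002 L134–L136)]
[cite: Lange2023AbelianVarietiesComplex, §7.2.4 Exercise (2) and §5.5] -/
theorem IsRiemannForm.isSemisimple_hodgeGroupLieRat_of_forall_rosati_eq (hη : IsRiemannForm Φ η)
    {G₀ : Matrix ι ι ℚ} (hG₀ : G₀.map (Rat.cast : ℚ → ℝ) = latticeGram Φ η)
    (htriv : ∀ B ∈ endAlgRat Φ, (∀ C ∈ endAlgRat Φ, B * C = C * B) → rosati G₀ B = B) :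
    LieAlgebra.IsSemisimple ℚ (hodgeGroupLieRat Φ) :=
  hη.isSemisimple_hodgeGroupLieRat_iff_forall_mem_endAlgRat_eq_zero.2 (hη.forall_mem_endAlgRat_eq_zero_of_forall_rosati_eq hG₀ htriv)

/-- No type IV and `dim X > 0` ⟹ `𝒜` is NOT abelian (so `X` is not of CM type: «`Hg(X)` is a torus iff `X` is of CM-type»): an
abelian `𝒜` would lie in `End⁰` (p36), hence vanish. [cite: MoonenZarhin1999LowDim, §1 (p0002 L134–L136)] [cite: Lange2023AbelianVarietiesComplex, §7.2.3 Prop. 7.2.6] -/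
theorem IsRiemannForm.not_isLieAbelian_hodgeGroupLieRat_of_forall_rosati_eq [Nonempty ι] (hη : IsRiemannForm Φ η)
    {G₀ : Matrix ι ι ℚ} (hG₀ : G₀.map (Rat.cast : ℚ → ℝ) = latticeGram Φ η)
    (htriv : ∀ B ∈ endAlgRat Φ, (∀ C ∈ endAlgRat Φ, B * C = C * B) → rosati G₀ B = B) :
    ¬ IsLieAbelian (hodgeGroupLieRat Φ) := by
  intro hab
  haveI := hab
  haveI := finite_hodgeGroupLieRat Φ
  haveI := hη.isSemisimple_hodgeGroupLieRat_of_forall_rosati_eq hG₀ htriv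
  -- a semisimple abelian Lie algebra is zero, but `dim_ℚ 𝒜 ≥ 1`
  haveI : Subsingleton (hodgeGroupLieRat Φ) := LieAlgebra.subsingleton_of_hasTrivialRadical_lie_abelian ℚ (hodgeGroupLieRat Φ)
  exact absurd Module.finrank_zero_of_subsingleton (finrank_hodgeGroupLieRat_pos Φ).ne'

end NoTypeFour

/-! ### §2 `𝒜` abelian ⟺ `Hg(X)` commutative (every complex torus) -/

section Commutative

variable {ι : Type*} [Fintype ι] [DecidableEq ι] {E : Type*} [NormedAddCommGroup E] [NormedSpace ℂ E]
  (Φ : (ι → ℝ) ≃L[ℝ] E)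

/-- **`𝒜` IS ABELIAN ⟺ `Hg(X)(ℝ)` IS COMMUTATIVE**, for EVERY complex torus (`𝒜 ⊗ ℝ = 𝔥𝔤_ℝ = Lie Hg(X)(ℝ)` and the analytic
group `Hg(X)(ℝ)` is connected). [cite: MoonenZarhin1999LowDim, §1 ("`Hg(X)` is a torus if and only if `X` is of CM-type")]
[cite: Lange2023AbelianVarietiesComplex, §7.2.3 Prop. 7.2.6] -/
theorem isLieAbelian_hodgeGroupLieRat_iff_hodgeGroup_comm :
    IsLieAbelian (hodgeGroupLieRat Φ) ↔ ∀ M ∈ hodgeGroup Φ, ∀ N ∈ hodgeGroup Φ, M * N = N * M := by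
  rw [isLieAbelian_iff_forall_mul_comm, hodgeGroupLieRat_comm_iff_hodgeGroupLie_comm, hodgeGroupLie_comm_iff_hodgeGroup_comm]

/-- `𝒜` abelian ⟺ `Hg(X)(ℂ)` commutative. [cite: MoonenZarhin1999LowDim, §1] -/
theorem isLieAbelian_hodgeGroupLieRat_iff_hodgeGroupC_comm :
    IsLieAbelian (hodgeGroupLieRat Φ) ↔ ∀ M ∈ hodgeGroupC Φ, ∀ N ∈ hodgeGroupC Φ, M * N = N * M := by
  rw [isLieAbelian_hodgeGroupLieRat_iff_hodgeGroup_comm, hodgeGroup_comm_iff_hodgeGroupC_comm]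

/-- `𝒜` abelian ⟺ the derived group `⁅Hg(X)(ℂ), Hg(X)(ℂ)⁆` is trivial. [cite: MoonenZarhin1999LowDim, §1] [cite: Gordon1997, §2.12 Proposition] -/
theorem isLieAbelian_hodgeGroupLieRat_iff_commutator_hodgeGroupC_eq_bot :
    IsLieAbelian (hodgeGroupLieRat Φ) ↔ ⁅hodgeGroupC Φ, hodgeGroupC Φ⁆ = ⊥ := by
  rw [isLieAbelian_hodgeGroupLieRat_iff_hodgeGroupC_comm, commutator_hodgeGroupC_eq_bot_iff_forall_comm]

end Commutative

/-! ### §3 Products under «no type IV»: the gen-42 criteria with arithmetic hypotheses -/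

section Products

variable {ι₁ ι₂ : Type*} [Fintype ι₁] [Fintype ι₂] [DecidableEq ι₁] [DecidableEq ι₂]
  {E₁ E₂ : Type*} [NormedAddCommGroup E₁] [NormedSpace ℂ E₁] [NormedAddCommGroup E₂] [NormedSpace ℂ E₂]
  {Φ₁ : (ι₁ → ℝ) ≃L[ℝ] E₁} (Φ₂ : (ι₂ → ℝ) ≃L[ℝ] E₂) {η₁ : E₁ [⋀^Fin 2]→L[ℝ] ℝ}

/-- **No type IV on `X₁`, `𝒜(X₂)` solvable ⟹ `Hom_ℚ(X₁, X₂) = 0 = Hom_ℚ(X₂, X₁)`** (a CM ∕ solvable-type torus has no non-zero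
homomorphism to or from a polarised torus without type-IV factors). [cite: MoonenZarhin1999LowDim, §3 Thm. (3.2) and Prop. (3.8)] -/
theorem IsRiemannForm.homRat_eq_bot_of_forall_rosati_eq_of_isSolvable (hη₁ : IsRiemannForm Φ₁ η₁)
    {G₀ : Matrix ι₁ ι₁ ℚ} (hG₀ : G₀.map (Rat.cast : ℚ → ℝ) = latticeGram Φ₁ η₁)
    (htriv : ∀ B ∈ endAlgRat Φ₁, (∀ C ∈ endAlgRat Φ₁, B * C = C * B) → rosati G₀ B = B)
    [LieAlgebra.IsSolvable (hodgeGroupLieRat Φ₂)] :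
    homRat Φ₁ Φ₂ = ⊥ ∧ homRat Φ₂ Φ₁ = ⊥ :=
  hη₁.homRat_eq_bot_of_forall_mem_endAlgRat_eq_zero_of_isSolvable Φ₂ (hη₁.forall_mem_endAlgRat_eq_zero_of_forall_rosati_eq hG₀ htriv)

/-- The same with `Hg(X₂)(ℂ)` COMMUTATIVE (`⁅Hg(X₂)(ℂ), Hg(X₂)(ℂ)⁆ = 1`; e.g. `X₂` of CM type): `Hom_ℚ(X₁, X₂) = 0 = Hom_ℚ(X₂, X₁)`.
[cite: MoonenZarhin1999LowDim, §3 Thm. (3.2) and Prop. (3.8)] [cite: Gordon1997, §2.12] -/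
theorem IsRiemannForm.homRat_eq_bot_of_forall_rosati_eq_of_commutator_hodgeGroupC_eq_bot (hη₁ : IsRiemannForm Φ₁ η₁)
    {G₀ : Matrix ι₁ ι₁ ℚ} (hG₀ : G₀.map (Rat.cast : ℚ → ℝ) = latticeGram Φ₁ η₁)
    (htriv : ∀ B ∈ endAlgRat Φ₁, (∀ C ∈ endAlgRat Φ₁, B * C = C * B) → rosati G₀ B = B)
    (h₂ : ⁅hodgeGroupC Φ₂, hodgeGroupC Φ₂⁆ = ⊥) : homRat Φ₁ Φ₂ = ⊥ ∧ homRat Φ₂ Φ₁ = ⊥ := by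
  haveI : IsLieAbelian (hodgeGroupLieRat Φ₂) := (isLieAbelian_hodgeGroupLieRat_iff_commutator_hodgeGroupC_eq_bot Φ₂).2 h₂
  exact hη₁.homRat_eq_bot_of_forall_rosati_eq_of_isSolvable Φ₂ hG₀ htriv

end Products

section EllipticCM

variable {ι₁ : Type*} [Fintype ι₁] [DecidableEq ι₁] {E₁ : Type*} [NormedAddCommGroup E₁] [NormedSpace ℂ E₁]
  {Φ₁ : (ι₁ → ℝ) ≃L[ℝ] E₁} {η₁ : E₁ [⋀^Fin 2]→L[ℝ] ℝ} {τ : ℂ} (hτ : τ.im ≠ 0)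

/-- **MOONEN–ZARHIN PROP. (3.8) WITH THE ARITHMETIC HYPOTHESIS**: `X₁` polarised without type-IV factors, `E_τ` a CM elliptic curve ⟹
`Hg(X₁ × E_τ) = Hg(X₁) × Hg(E_τ)` («or … an embedding of `k` into the center of `End⁰(X)`» — impossible when that centre is
Rosati-fixed, by g42-#8's antisymmetric embedding). [cite: MoonenZarhin1999LowDim, §3 Prop. (3.8) (p0007 L55–L72)] -/
theorem IsRiemannForm.hodgeGroupC_prod_ellipticPeriod_eq_blockDiagProd_of_forall_rosati_eq (hη₁ : IsRiemannForm Φ₁ η₁)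
    {G₀ : Matrix ι₁ ι₁ ℚ} (hG₀ : G₀.map (Rat.cast : ℚ → ℝ) = latticeGram Φ₁ η₁)
    (htriv : ∀ B ∈ endAlgRat Φ₁, (∀ C ∈ endAlgRat Φ₁, B * C = C * B) → rosati G₀ B = B) (hCM : ellipticEnd hτ ≠ ⊥) :
    hodgeGroupC (prodPeriod Φ₁ (ellipticPeriod hτ)) = blockDiagProd (hodgeGroupC Φ₁) (hodgeGroupC (ellipticPeriod hτ)) :=
  hη₁.hodgeGroupC_prod_ellipticPeriod_eq_blockDiagProd_of_forall_mem_endAlgRat_eq_zero hτ hCM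
    (hη₁.forall_mem_endAlgRat_eq_zero_of_forall_rosati_eq hG₀ htriv)

/-- … hence `X₁ × E_τ` is stably nondegenerate whenever `X₁` is (Tate: `Dᵖ(E_τⁿ) = H^{2p}_Hodge(E_τⁿ)`).
[cite: MoonenZarhin1999LowDim, §3 Prop. (3.8) and Thm. (3.2)(2)] [cite: Lange2023AbelianVarietiesComplex, §7.3.3 Exercise (3)(a)] -/
theorem IsRiemannForm.forall_divisorClasses_powPeriod_prod_ellipticPeriod_eq_hodgeClasses_of_forall_rosati_eq
    (hη₁ : IsRiemannForm Φ₁ η₁) {G₀ : Matrix ι₁ ι₁ ℚ} (hG₀ : G₀.map (Rat.cast : ℚ → ℝ) = latticeGram Φ₁ η₁)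
    (htriv : ∀ B ∈ endAlgRat Φ₁, (∀ C ∈ endAlgRat Φ₁, B * C = C * B) → rosati G₀ B = B) (hCM : ellipticEnd hτ ≠ ⊥)
    (hX₁ : ∀ k p, divisorClasses (powPeriod Φ₁ k) p = hodgeClasses (powPeriod Φ₁ k) p) :
    ∀ k p, divisorClasses (powPeriod (prodPeriod Φ₁ (ellipticPeriod hτ)) k) p =
      hodgeClasses (powPeriod (prodPeriod Φ₁ (ellipticPeriod hτ)) k) p :=
  hη₁.forall_divisorClasses_powPeriod_prod_ellipticPeriod_eq_hodgeClasses_of_forall_mem_endAlgRat_eq_zero hτ hCM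
    (hη₁.forall_mem_endAlgRat_eq_zero_of_forall_rosati_eq hG₀ htriv) hX₁

end EllipticCM

end ComplexTorus

end Literature.Geometry.Kaehler
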